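import Literature.AlgebraicGeometry.Resolution.LocalUniformizationAbhyankarPlaces
import Literature.AlgebraicGeometry.Resolution.AffineModelLU
import Mathlib.RingTheory.Smooth.Basic
import HarnessLib

/-!
# A residually rational Abhyankar place dominating `A_P` yields a separable regular local model

Line `birth` of crux `SharpStrata.SepExcModels` (stmt-ResolutionOfSingularities-16828,
`Cruxes/SepExcModels/Lines/birth.lean`), lead c1, tool stub (T2, ring form)
`stub_model_of_ratAbhyankarPlace`, PROVED.

Setting: `k` perfect, `A` a finitely generated `k`-algebra with fraction field `K`, `R = A_P` realised
inside `K`, and `O` a valuation ring of `K` containing `R`, dominating it (`𝔪_R ⊆ 𝔪_O`), an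
ABHYANKAR place of `K | k` (`IsAbhyankarPlace`, `Literature/…/ValuedFunctionFields.lean`) and
RESIDUALLY RATIONAL over `R` (every element of `O` is congruent to an element of `R` modulo `𝔪_O`).
Conclusion (the third disjunct of `SepExcAt` in ring form): some `B = R[s] ⊆ K` (`s` finite) carries
a prime `𝔮` over `𝔪_R` with `B_𝔮` regular and `(B/𝔮)[1/g]` smooth over `κ(R) = R/𝔪_R` for some
`g ∉ 𝔮` (here `g = 1`).

## Proof

* Knaf–Kuhlmann 2005, Thm. 1.1 in the tree's relative affine form over a perfect ground field
  (`relLU_at_abhyankarPlace_of_perfectField`, `LocalUniformizationAbhyankarPlaces.lean`), applied to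
  the image `A'` of `A` in `K` (finitely generated, `A' ⊆ R ⊆ O`), gives a finitely generated
  `N = k[t] ⊇ A'` inside `O` with `Frac N = K` and `N` regular at the centre `𝔫 = 𝔪_O ∩ N`.
* `B := R[t]`, `𝔮 := 𝔪_O ∩ B`. Then `N ⊆ B ⊆ O`, `𝔮 ∩ N = 𝔫`, and every element of `B` is `a/u`
  with `a, u ∈ N`, `v(u) = 1` (denominators from `A ∖ P` are units of `R ⊆ O`), so `B_𝔮 = N_𝔫` is
  regular (`isRegularLocalRing_localization_of_sandwich`, `AffineModelLU.lean`).
* `𝔪_R ⊆ 𝔮` by domination, and `κ(R) → B/𝔮` is injective (`𝔮 ∩ R` is a proper ideal of the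
  local ring `R`) and surjective (residual rationality: `b ≡ r mod 𝔪_O` with `r ∈ R` gives
  `b - r ∈ 𝔮`); `B/𝔮 → (B/𝔮)[1/1]` is an isomorphism, so `(B/𝔮)[1/1] ≅ κ(R)` is smooth over `κ(R)`.

## Sources

* H. Knaf, F.-V. Kuhlmann, *Abhyankar places admit local uniformization in any characteristic*,
  Ann. Sci. ÉNS 38 (2005) 833–846, Thm. 1.1. [KnafKuhlmann2005]
* A. Benito, O. Piltant, A. J. Reguera, *Small irreducible components of arc spaces in positive
  characteristic*, J. Pure Appl. Algebra 226 (2022) 107113, Question 6.6. [BenitoPiltantReguera2022]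
-/

noncomputable section

-- single-problem summit: the doubled namespace component `ResolutionOfSingularities` is forced
set_option linter.dupNamespace false

open Literature.AlgebraicGeometry.Resolution IsLocalRing

namespace Summit.ResolutionOfSingularities.ResolutionOfSingularities.Theorems.SepExcModels.RatAbhyankarModel

/-- An algebra whose structure map is bijective is smooth (it is isomorphic, as an algebra, to the
base, which is smooth over itself). [folklore] -/
theorem smooth_of_bijective_algebraMap {F L : Type*} [CommRing F] [CommRing L] [Algebra F L]
    (h : Function.Bijective (algebraMap F L)) : Algebra.Smooth F L :=
  haveI : Algebra.Smooth F F := ⟨inferInstance, inferInstance⟩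
  Algebra.Smooth.of_equiv (AlgEquiv.ofBijective (Algebra.ofId F L) h)

/-- A localisation `T = S[1/x]` of a ring `S` away from a UNIT `x` has bijective structure map
`S → T` (`IsLocalization.atUnit` is an `S`-algebra isomorphism over the structure map). [folklore] -/
theorem bijective_algebraMap_of_away_isUnit {S T : Type*} [CommRing S] [CommRing T] [Algebra S T]
    (x : S) (hx : IsUnit x) [IsLocalization.Away x T] : Function.Bijective (algebraMap S T) := by
  have he : ⇑(IsLocalization.atUnit S T x hx) = ⇑(algebraMap S T) :=
    funext fun y => by simpa using (IsLocalization.atUnit S T x hx).commutes y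
  rw [← he]
  exact (IsLocalization.atUnit S T x hx).bijective

/-- **A residually rational Abhyankar place dominating `R = A_P` yields a separable regular
birational local model** (registered tool stub T2, ring form, of line `birth` of crux
`SepExcModels`). Let `k` be perfect, `A` a finitely generated `k`-algebra with fraction field `K`,
`R = A_P` (inside `K`), and `O` a valuation ring of `K` containing `R`, dominating it
(`𝔪_R ⊆ 𝔪_O`), Abhyankar over (the image of) `k`, and residually rational over `R` (every element
of `O` is congruent to an element of `R` modulo `𝔪_O`). Then some `B = R[s] ⊆ K` (`s` finite) has
a prime `𝔮` over `𝔪_R` with `B_𝔮` regular and `(B/𝔮)[1/g]` smooth over `κ(R)` for some `g ∉ 𝔮`.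
Proof: Knaf–Kuhlmann 2005 Thm. 1.1 (`relLU_at_abhyankarPlace_of_perfectField`, applied to the
image of `A`) gives a finitely generated `N = k[t] ⊇ A` inside `O`, birational and regular at the
centre; `B := R[t]`, `𝔮 := 𝔪_O ∩ B`; `B_𝔮 = N_{centre}` by the sandwich
(`isRegularLocalRing_localization_of_sandwich`: denominators from `A ∖ P` are units of `O`), and
`B/𝔮 = κ(R)` by residual rationality, so `g = 1`. [cite: KnafKuhlmann2005, Thm. 1.1] -/
theorem stub_model_of_ratAbhyankarPlace {k A K R : Type} [Field k] [PerfectField k]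
    [CommRing A] [Algebra k A] [Algebra.FiniteType k A] [Field K] [Algebra k K] [Algebra A K]
    [IsScalarTower k A K] [IsFractionRing A K] [CommRing R] [IsLocalRing R] [Algebra A R]
    [Algebra R K] [IsScalarTower A R K] (P : Ideal A) [P.IsPrime] [IsLocalization.AtPrime R P]
    (hfg : (⊤ : IntermediateField k K).FG)
    (O : ValuationSubring K) (hRO : ∀ r : R, algebraMap R K r ∈ O)
    (hdom : ∀ r ∈ IsLocalRing.maximalIdeal R, O.valuation (algebraMap R K r) < 1)
    (hAbh : IsAbhyankarPlace O (algebraMap k K).fieldRange ⊤)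
    (hrat : ∀ x ∈ O, ∃ r : R, O.valuation (algebraMap R K r - x) < 1) :
    ∃ (s : Finset K) (𝔮 : Ideal (Algebra.adjoin R (s : Set K))) (_ : 𝔮.IsPrime)
      (hle : IsLocalRing.maximalIdeal R ≤
        𝔮.comap (algebraMap R (Algebra.adjoin R (s : Set K)))),
      IsRegularLocalRing (Localization.AtPrime 𝔮) ∧
        ∃ g : Algebra.adjoin R (s : Set K), g ∉ 𝔮 ∧
          @Algebra.Smooth (R ⧸ IsLocalRing.maximalIdeal R) _
            (Localization.Away (Ideal.Quotient.mk 𝔮 g)) _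
            ((algebraMap _ (Localization.Away (Ideal.Quotient.mk 𝔮 g))).comp
              (Ideal.quotientMap 𝔮 (algebraMap R (Algebra.adjoin R (s : Set K))) hle)).toAlgebra := by
  classical
  -- (1) `A ⊆ R ⊆ O` and `k ⊆ O` inside `K`
  have hAK : ∀ a : A, algebraMap A K a = algebraMap R K (algebraMap A R a) :=
    fun a => IsScalarTower.algebraMap_apply A R K a
  have hAO : ∀ a : A, algebraMap A K a ∈ O := fun a => by
    rw [hAK]
    exact hRO _
  have hk : ∀ c : k, algebraMap k K c ∈ O := fun c => by
    rw [IsScalarTower.algebraMap_apply k A K]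
    exact hAO _
  -- (2) the image `A'` of `A` in `K`: finitely generated, inside `O`, with fraction field `K`
  set A' : Subalgebra k K := (IsScalarTower.toAlgHom k A K).range with hA'def
  have hmemA' : ∀ a : A, algebraMap A K a ∈ A' := fun a => (AlgHom.mem_range _).mpr ⟨a, rfl⟩
  have hA'fg : A'.FG := by
    rw [hA'def, ← Algebra.map_top]
    exact Subalgebra.FG.map _ Algebra.FiniteType.out
  have hA'O : A'.toSubring ≤ O.toSubring := by
    intro x hx
    obtain ⟨a, rfl⟩ := (AlgHom.mem_range _).mp (Subalgebra.mem_toSubring.mp hx)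
    exact hAO a
  -- (3) Knaf–Kuhlmann 2005, Thm. 1.1 (relative affine form over the perfect field `k`)
  obtain ⟨N, hNO, hA'N, ⟨t, ht⟩, hNfr, hNreg⟩ :=
    relLU_at_abhyankarPlace_of_perfectField hfg O hk hAbh A' hA'fg hA'O
  have htN : (t : Set K) ⊆ N := ht ▸ Algebra.subset_adjoin
  have hAN : ∀ a : A, algebraMap A K a ∈ N := fun a => hA'N (hmemA' a)
  -- (4) `B := R[t]`, sandwiched `N ⊆ B ⊆ O`
  set B : Subalgebra R K := Algebra.adjoin R (t : Set K) with hBdef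
  have hBO : B.toSubring ≤ O.toSubring := by
    intro x hx
    refine Algebra.adjoin_induction (p := fun x _ => x ∈ O) ?_ ?_ ?_ ?_ (show x ∈ B from hx)
    · exact fun x hx => hNO (htN hx)
    · exact fun r => hRO r
    · exact fun _ _ _ _ hx hy => add_mem hx hy
    · exact fun _ _ _ _ hx hy => mul_mem hx hy
  have hNB : N.toSubring ≤ B.toSubring := by
    intro x hx
    have hx' : x ∈ Algebra.adjoin k (t : Set K) := ht ▸ (show x ∈ N from hx)
    refine Algebra.adjoin_induction (p := fun x _ => x ∈ B) ?_ ?_ ?_ ?_ hx'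
    · exact fun x hx => Algebra.subset_adjoin hx
    · intro c
      rw [IsScalarTower.algebraMap_apply k A K, hAK]
      exact B.algebraMap_mem _
    · exact fun _ _ _ _ hx hy => add_mem hx hy
    · exact fun _ _ _ _ hx hy => mul_mem hx hy
  -- (5) the centre `𝔮 := 𝔪_O ∩ B`, a prime over `𝔪_R`
  set 𝔮 : Ideal B := Ideal.comap (Subring.inclusion hBO : B →+* O) (maximalIdeal O) with h𝔮def
  haveI h𝔮 : 𝔮.IsPrime := Ideal.comap_isPrime _ _
  have hmem𝔮 : ∀ b : B, b ∈ 𝔮 ↔ O.valuation (b : K) < 1 := fun b =>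
    Ideal.mem_comap.trans (ValuationSubring.valuation_lt_one_iff O _)
  have hle : maximalIdeal R ≤ 𝔮.comap (algebraMap R B) := fun r hr => by
    rw [Ideal.mem_comap, hmem𝔮]
    exact hdom r hr
  -- (6) regularity of `B_𝔮 = N_𝔫` by the sandwich
  have hunitv : ∀ u : P.primeCompl, O.valuation (algebraMap A K (u : A)) = 1 := fun u => by
    obtain ⟨v, hv⟩ := IsLocalization.map_units R u
    refine valuation_eq_one_of_mul_eq_one O (y := algebraMap R K (↑v⁻¹ : R)) (hAO u) (hRO _) ?_
    rw [hAK, ← hv, ← map_mul, Units.mul_inv, map_one]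
  have hQ : ∀ x ∈ B, ∃ a u : K, a ∈ N ∧ u ∈ N ∧ O.valuation u = 1 ∧ x * u = a := by
    intro x hx
    refine Algebra.adjoin_induction (p := fun x _ => ∃ a u : K, a ∈ N ∧ u ∈ N ∧
      O.valuation u = 1 ∧ x * u = a) ?_ ?_ ?_ ?_ hx
    · intro x hx
      exact ⟨x, 1, htN hx, one_mem _, map_one _, mul_one _⟩
    · intro r
      obtain ⟨a, u, rfl⟩ := IsLocalization.exists_mk'_eq P.primeCompl r
      refine ⟨algebraMap A K a, algebraMap A K (u : A), hAN a, hAN u, hunitv u, ?_⟩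
      rw [hAK, hAK, ← map_mul, IsLocalization.mk'_spec]
    · rintro x y - - ⟨a₁, s₁, ha₁, hs₁, hv₁, h₁⟩ ⟨a₂, s₂, ha₂, hs₂, hv₂, h₂⟩
      refine ⟨a₁ * s₂ + a₂ * s₁, s₁ * s₂, add_mem (mul_mem ha₁ hs₂) (mul_mem ha₂ hs₁),
        mul_mem hs₁ hs₂, by rw [map_mul, hv₁, hv₂, mul_one], ?_⟩
      rw [← h₁, ← h₂]; ring
    · rintro x y - - ⟨a₁, s₁, ha₁, hs₁, hv₁, h₁⟩ ⟨a₂, s₂, ha₂, hs₂, hv₂, h₂⟩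
      refine ⟨a₁ * a₂, s₁ * s₂, mul_mem ha₁ ha₂, mul_mem hs₁ hs₂,
        by rw [map_mul, hv₁, hv₂, mul_one], ?_⟩
      rw [← h₁, ← h₂]; ring
  haveI : IsFractionRing N.toSubring K := hNfr
  have hreg : IsRegularLocalRing (Localization.AtPrime 𝔮) := by
    refine isRegularLocalRing_localization_of_sandwich hNB 𝔮
      (Ideal.comap (Subring.inclusion hNO) (maximalIdeal O)) ?_ ?_ hNreg
    · rw [h𝔮def, Ideal.comap_comap]
      rfl
    · intro x
      obtain ⟨a, u, ha, hu, hv, hxu⟩ := hQ x x.2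
      refine ⟨⟨a, ha⟩, ⟨u, hu⟩, ?_, hxu⟩
      rw [hmem𝔮]
      change ¬ O.valuation u < 1
      rw [hv]
      exact lt_irrefl 1
  -- (7) `κ(R) = B/𝔮 = (B/𝔮)[1/1]`, smooth over `κ(R)`
  have h1 : (1 : B) ∉ 𝔮 := (Ideal.ne_top_iff_one 𝔮).mp h𝔮.ne_top
  have hinj : Function.Injective (Ideal.quotientMap 𝔮 (algebraMap R B) hle) :=
    Ideal.quotientMap_injective'
      (IsLocalRing.le_maximalIdeal (Ideal.comap_ne_top _ h𝔮.ne_top))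
  have hsurj : Function.Surjective (Ideal.quotientMap 𝔮 (algebraMap R B) hle) := by
    intro y
    obtain ⟨b, rfl⟩ := Ideal.Quotient.mk_surjective y
    obtain ⟨r, hr⟩ := hrat (b : K) (hBO b.2)
    refine ⟨Ideal.Quotient.mk _ r, ?_⟩
    rw [Ideal.quotientMap_mk, Ideal.Quotient.eq, hmem𝔮]
    exact hr
  letI instκ : Algebra (R ⧸ maximalIdeal R) (Localization.Away (Ideal.Quotient.mk 𝔮 (1 : B))) :=
    ((algebraMap _ (Localization.Away (Ideal.Quotient.mk 𝔮 (1 : B)))).comp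
      (Ideal.quotientMap 𝔮 (algebraMap R B) hle)).toAlgebra
  have hbij : Function.Bijective
      (algebraMap (R ⧸ maximalIdeal R) (Localization.Away (Ideal.Quotient.mk 𝔮 (1 : B)))) :=
    (bijective_algebraMap_of_away_isUnit (T := Localization.Away (Ideal.Quotient.mk 𝔮 (1 : B)))
      (Ideal.Quotient.mk 𝔮 (1 : B)) (isUnit_one.map _)).comp ⟨hinj, hsurj⟩
  exact ⟨t, 𝔮, h𝔮, hle, hreg, 1, h1, smooth_of_bijective_algebraMap hbij⟩

end Summit.ResolutionOfSingularities.ResolutionOfSingularities.Theorems.SepExcModels.RatAbhyankarModel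

end
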